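import Summits.QuantumFields.YangMills.Theorems.UnitScaleTiltProp8ChartLocality
import Summits.QuantumFields.YangMills.Theorems.UnitScaleTiltProp8ChartTransport
import Summits.QuantumFields.YangMills.Theorems.UnitScaleTiltProp8FlatPortChart
import Literature.MathematicalPhysics.QuantumFieldTheory.BalabanImbrieJaffe1984to88.BIJ85ContourLocality
import Literature.MathematicalPhysics.QuantumFieldTheory.Balaban1983to89.B15DeterminingSets
import Literature.MathematicalPhysics.QuantumFieldTheory.BalabanImbrieJaffe1984to88.BIJ88RT51Background
import HarnessLib

/-!
# Route `UnitScaleTilt`, crux K1 «MinimiserStabilityRegPr» (stmt-QuantumFields-19200), leaf V2′ — the P2→P3 BRIDGE (hH of `ChartRemainderAt`),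
# part B1: **LATTICE GEOMETRY — staircases stay in their block, the local size of the comb functional, the labels of the `j`-fold centres**

Cell `ym3-torus`, seat `ym3-torus-p1` g18.  Bookkeeping for the right inverse `H X = H₀X̃′ + dφ` of the true linearisation (part C): (§1) every bond of a
staircase of [Balaban1987RG1] (0.3) issued from the centre `emb y` has both end-points in `B(y)`, so the comb mean `λ̄_Z(y)` is bounded by `(d+2)L·sup_{B(y)}‖Z‖`
and the hierarchical comb functional `Λ_j(Y)(y)` (part A) by `(d+2)L^{j+1}·sup_{B^j(y)}‖Y‖`; (§2) the `j`-fold centre `embIter j y` has labels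
`y_μL^j + (L^j−1)/2` (so its in-block label is the central one; `B^j(embIter j y) = y` is `BIJ88RT51Background.iterBlockOf_embIter`).  Tents and the
territory collar follow in part B2.  Theorems only; nothing of Bałaban's asserted.  NOT a claim about the mass gap.

References: T. Bałaban, CMP **109** (1987) 249–301 [Balaban1987RG1] ((0.1)–(0.3) pp.251–252); CMP **98** (1985) 17–51 [Balaban1985Averaging] ((62) p.28);
CMP **96** (1984) 223–250 [Balaban1984PropagatorsII] ((2.1)–(2.4) p.224); CMP **95** (1984) 17–40 [Balaban1984PropagatorsI] ((1.18) p.20).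
-/

noncomputable section

open scoped BigOperators

namespace Summit.QuantumFields.YangMills.Theorems.ChartHInv

open Literature.MathematicalPhysics.QuantumFieldTheory.Balaban1983to89
open T4Continuum BlockAveraging BlockAveragingEMLLinearised LatticeFieldCalculus
open B5Eq118OneStroke (iterBlockOf iterBlockOf_zero iterBlockOf_succ val_iterBlockOf)
open B15DeterminingSets (embIter)
open Literature.MathematicalPhysics.QuantumFieldTheory.BalabanImbrieJaffe1984to88.BIJ88RT51Background (iterBlockOf_embIter)
open B5Prop12FieldsLattice (distSite)
open B5Eq117TorusCarriers (Mk)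
open B6SectADomainsV1 (Domains)
open B11Eq115Space (levOf)
open BlockAveragingHaarAC (exists_take_of_mem_walk)
open Literature.MathematicalPhysics.QuantumFieldTheory.BalabanImbrieJaffe1984to88.BIJ85GaugeFunction5113 (blk)
open Literature.MathematicalPhysics.QuantumFieldTheory.BalabanImbrieJaffe1984to88.BIJ85ContourLocality (norm_bondAvgIter_le_tower)
open Summit.QuantumFields.YangMills.Theorems.Prop8Chart (norm_walkSum_le_of_steps norm_card_inv_smul_sum_le)

variable {P : Params} {n : Type*}

/-! ## §1 Staircases stay in their block; local size of `λ̄` and `Λ_j` -/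

/-- **EVERY BOND OF A STAIRCASE OF (0.3) FROM THE CENTRE `emb y` HAS BOTH END-POINTS IN `B(y)`** (offsets `|n_ν| ≤ (L−1)/2`, prefixes of a staircase
have net displacements between `0` and `n_ν`). [cite: Balaban1987RG1, (0.3) p.252] -/
theorem blockOf_of_mem_walk_stairWord {j : ℕ} (hj : j + 1 ≤ P.m + P.K) (y : Site P (j + 1)) (σ : Equiv.Perm (Fin P.d))
    (r : Fin P.d → Fin P.L) {s : LStep P j} (hs : s ∈ walk (emb y) (stairWord σ (off r))) :
    blockOf s.bond.src = y ∧ blockOf s.bond.tgt = y := by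
  obtain ⟨k₁, k₂, h1, h2⟩ := exists_take_of_mem_walk _ _ s hs
  have hL1 : 1 < P.L := P.hL.2
  have hL := AveragingRT.two_mul_half_add_one P
  set hh : ℕ := (P.L - 1) / 2 with hhh
  -- in every coordinate the label of the source is `y_κ L + u_κ` with `u_κ ≤ L − 1`, and `u_ν ≤ L − 2` in the bond's direction
  have hcoord : ∀ κ : Fin P.d, ∃ u : ℕ, (s.bond.src κ).val = (y κ).val * P.L + u ∧ u + 1 ≤ P.L ∧ (κ = s.bond.dir → u + 2 ≤ P.L) := by
    intro κ
    have hb1 := netDisp_take_stairWord σ (off r) κ k₁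
    have hb2 := netDisp_take_stairWord σ (off r) κ k₂
    have hn := off_bounds r κ
    set t₁ : ℤ := netDisp ((stairWord σ (off r)).take k₁) κ with ht₁
    have hlo : 0 ≤ (hh : ℤ) + t₁ := by
      rcases le_total 0 (off r κ) with h0 | h0
      · rw [min_eq_left h0] at hb1; omega
      · rw [min_eq_right h0] at hb1; omega
    have hhi : (hh : ℤ) + t₁ ≤ (P.L : ℤ) - 1 := by
      rcases le_total 0 (off r κ) with h0 | h0
      · rw [max_eq_right h0] at hb1; omega
      · rw [max_eq_left h0] at hb1; omega
    have hhi' : κ = s.bond.dir → (hh : ℤ) + t₁ ≤ (P.L : ℤ) - 2 := by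
      intro hκ
      have h2κ := h2 κ
      rw [if_pos hκ] at h2κ
      have hk2 : netDisp ((stairWord σ (off r)).take k₂) κ ≤ max 0 (off r κ) := hb2.2
      rcases le_total 0 (off r κ) with h0 | h0
      · rw [max_eq_right h0] at hk2; omega
      · rw [max_eq_left h0] at hk2; omega
    obtain ⟨u, hu⟩ : ∃ u : ℕ, (u : ℤ) = (hh : ℤ) + t₁ := ⟨((hh : ℤ) + t₁).toNat, Int.toNat_of_nonneg hlo⟩
    have hsrc : s.bond.src κ = (((y κ).val * P.L + u : ℕ) : ZMod (P.sitesPerDir j)) := by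
      rw [h1 κ]
      show (((y κ).val * P.L + (P.L - 1) / 2 : ℕ) : ZMod (P.sitesPerDir j)) + ((t₁ : ℤ) : ZMod (P.sitesPerDir j)) = _
      have ht : t₁ = (u : ℤ) - (hh : ℤ) := by omega
      rw [ht, ← hhh]
      push_cast
      ring
    have hlt : (y κ).val * P.L + u < P.sitesPerDir j := by
      have hy : (y κ).val + 1 ≤ P.sitesPerDir (j + 1) := ZMod.val_lt (y κ)
      have h3 : ((y κ).val + 1) * P.L ≤ P.sitesPerDir (j + 1) * P.L := Nat.mul_le_mul_right _ hy
      rw [P.sitesPerDir_eq_mul_succ hj]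
      rw [Nat.add_mul, one_mul] at h3
      omega
    refine ⟨u, ?_, by omega, fun hκ => by have := hhi' hκ; omega⟩
    rw [hsrc, ZMod.val_natCast, Nat.mod_eq_of_lt hlt]
  have hLpos : 0 < P.L := P.L_pos
  constructor
  · funext κ
    apply ZMod.val_injective
    obtain ⟨u, hu, hu1, -⟩ := hcoord κ
    rw [Site.val_blockOf hj, hu, Nat.mul_comm, Nat.mul_add_div hLpos, Nat.div_eq_of_lt (by omega), add_zero]
  · funext κ
    apply ZMod.val_injective
    obtain ⟨u, hu, hu1, hu2⟩ := hcoord κ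
    rw [Site.val_blockOf hj]
    by_cases hκ : κ = s.bond.dir
    · have hu2' := hu2 hκ
      have hval : (s.bond.tgt κ).val = (y κ).val * P.L + (u + 1) := by
        have hlt : (y κ).val * P.L + (u + 1) < P.sitesPerDir j := by
          have hy : (y κ).val + 1 ≤ P.sitesPerDir (j + 1) := ZMod.val_lt (y κ)
          have h3 : ((y κ).val + 1) * P.L ≤ P.sitesPerDir (j + 1) * P.L := Nat.mul_le_mul_right _ hy
          rw [P.sitesPerDir_eq_mul_succ hj]
          rw [Nat.add_mul, one_mul] at h3
          omega
        have htgt : s.bond.tgt κ = s.bond.src κ + 1 := by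
          subst hκ
          simp [PBond.tgt, Site.shift]
        rw [htgt, ZMod.val_add, ZMod.val_one, hu, Nat.mod_eq_of_lt (by omega), Nat.add_assoc]
      rw [hval, Nat.mul_comm, Nat.mul_add_div hLpos, Nat.div_eq_of_lt (by omega), add_zero]
    · have htgt : s.bond.tgt κ = s.bond.src κ := by
        simp [PBond.tgt, Site.shift, Function.update_of_ne hκ]
      rw [htgt, hu, Nat.mul_comm, Nat.mul_add_div hLpos, Nat.div_eq_of_lt (by omega), add_zero]

section Norms

open scoped Matrix.Norms.L2Operator

variable [Fintype n] [DecidableEq n]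

/-- **LOCAL SIZE OF THE COMB MEAN**: if `‖Z(b)‖ ≤ a` on the bonds with both end-points in `B(y)`, then `‖λ̄_Z(y)‖ ≤ (d+2)L·a` (a staircase has at most
`(d+2)L` steps, all inside `B(y)`). [cite: Balaban1985Averaging, (62) p.28; Balaban1987RG1, (0.3) p.252] -/
theorem norm_combMean_le_of_local {j : ℕ} (hj : j + 1 ≤ P.m + P.K) (Z : PBond P j → Matrix n n ℂ) (y : Site P (j + 1)) {a : ℝ} (ha : 0 ≤ a)
    (h : ∀ b : PBond P j, blockOf b.src = y → blockOf b.tgt = y → ‖Z b‖ ≤ a) :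
    ‖combMean Z y‖ ≤ ((P.d + 2) * P.L : ℕ) * a := by
  rw [combMean_def]
  refine norm_card_inv_smul_sum_le (by positivity) fun i => ?_
  have hsteps : ∀ st ∈ walk (emb y) (stairWord i.2.1 (off i.1)), ‖Z st.bond‖ ≤ a := fun st hst =>
    have hb := blockOf_of_mem_walk_stairWord hj y i.2.1 i.1 hst
    h st.bond hb.1 hb.2
  refine (norm_walkSum_le_of_steps Z _ hsteps).trans ?_
  have hlen := length_walk_stairWord_le (emb y) i.2.1 i.1
  exact mul_le_mul_of_nonneg_right (by exact_mod_cast hlen) ha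

/-- **LOCAL SIZE OF `Q_k`**: `‖(Q_kY)(c)‖ ≤ a` if `‖Y(b)‖ ≤ a` on the fine bonds whose end-points have their `k`-blocks among the end-points of `c`
(`BIJ85ContourLocality.norm_bondAvgIter_le_tower`, re-read with `iterBlockOf`). [cite: Balaban1984PropagatorsI, (1.18) p.20] -/
theorem norm_bondAvgIter_le_of_local {k : ℕ} (hk : k ≤ P.m + P.K) (Y : PBond P 0 → Matrix n n ℂ) (c : PBond P k) {a : ℝ}
    (h : ∀ b : PBond P 0, (iterBlockOf k b.src = c.src ∨ iterBlockOf k b.src = c.tgt) →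
      (iterBlockOf k b.tgt = c.src ∨ iterBlockOf k b.tgt = c.tgt) → ‖Y b‖ ≤ a) :
    ‖bondAvgIter k Y c‖ ≤ a := by
  refine norm_bondAvgIter_le_tower k hk {z | z = c.src ∨ z = c.tgt} Y a (fun b hb1 hb2 => ?_) c (Or.inl rfl) (Or.inr rfl)
  simp only [Set.mem_setOf_eq, B6SectAOntoV1.blk_eq_iterBlockOf] at hb1 hb2
  exact h b hb1 hb2

variable (Λ : (i : ℕ) → (PBond P 0 → Matrix n n ℂ) → Site P i → Matrix n n ℂ)
  (hΛ0 : ∀ Y y, Λ 0 Y y = 0)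
  (hΛs : ∀ (i : ℕ) (Y : PBond P 0 → Matrix n n ℂ) (y : Site P (i + 1)), Λ (i + 1) Y y = (P.L ^ i : ℕ) • combMean (bondAvgIter i Y) y + Λ i Y (emb y))

include hΛ0 hΛs in
/-- **LOCAL SIZE OF THE HIERARCHICAL COMB FUNCTIONAL**: if `‖Y(b)‖ ≤ a` on the fine bonds with both end-points in `B^k(y)`, then
`‖Λ_k(Y)(y)‖ ≤ (d+2)L·(Σ_{i<k} L^i)·a` (one comb of `(d+2)L` steps of size `L^i·a` per level). [cite: Balaban1985Averaging, (62) p.28; Balaban1984PropagatorsI, (1.18) p.20] -/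
theorem norm_combFamily_le_of_local : ∀ (k : ℕ), k ≤ P.m + P.K → ∀ (Y : PBond P 0 → Matrix n n ℂ) (y : Site P k) {a : ℝ}, 0 ≤ a →
    (∀ b : PBond P 0, iterBlockOf k b.src = y → iterBlockOf k b.tgt = y → ‖Y b‖ ≤ a) →
    ‖Λ k Y y‖ ≤ ((P.d + 2) * P.L : ℕ) * (∑ i ∈ Finset.range k, (P.L : ℝ) ^ i) * a
  | 0, _, Y, y, a, _, _ => by rw [hΛ0]; simp
  | k + 1, hk, Y, y, a, ha, h => by
    rw [hΛs]
    -- the comb at level `k + 1`: `Q_kY` is bounded by `a` on the bonds inside `B(y)`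
    have hQ : ∀ b : PBond P k, blockOf b.src = y → blockOf b.tgt = y → ‖bondAvgIter k Y b‖ ≤ a := by
      intro b hbs hbt
      refine norm_bondAvgIter_le_of_local (by omega) Y b fun b' h1 h2 => h b' ?_ ?_
      · rw [iterBlockOf_succ]; rcases h1 with e | e <;> rw [e] <;> assumption
      · rw [iterBlockOf_succ]; rcases h2 with e | e <;> rw [e] <;> assumption
    have hcomb := norm_combMean_le_of_local hk (bondAvgIter k Y) y ha hQ
    -- the lower levels, inside the central sub-block `emb y`
    have hsub : ∀ b : PBond P 0, iterBlockOf k b.src = emb y → iterBlockOf k b.tgt = emb y → ‖Y b‖ ≤ a := by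
      intro b hbs hbt
      refine h b ?_ ?_
      · rw [iterBlockOf_succ, hbs, Site.blockOf_emb hk]
      · rw [iterBlockOf_succ, hbt, Site.blockOf_emb hk]
    have ih := norm_combFamily_le_of_local k (by omega) Y (emb y) ha hsub
    have hpos : (0 : ℝ) ≤ ((P.d + 2) * P.L : ℕ) := by positivity
    calc ‖(P.L ^ k : ℕ) • combMean (bondAvgIter k Y) y + Λ k Y (emb y)‖
        ≤ ‖(P.L ^ k : ℕ) • combMean (bondAvgIter k Y) y‖ + ‖Λ k Y (emb y)‖ := norm_add_le _ _
      _ ≤ (P.L : ℝ) ^ k * (((P.d + 2) * P.L : ℕ) * a) + ((P.d + 2) * P.L : ℕ) * (∑ i ∈ Finset.range k, (P.L : ℝ) ^ i) * a := by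
          refine add_le_add ?_ ih
          rw [← Nat.cast_smul_eq_nsmul ℝ, norm_smul, Real.norm_eq_abs, Nat.abs_cast, Nat.cast_pow]
          exact mul_le_mul_of_nonneg_left hcomb (by positivity)
      _ = ((P.d + 2) * P.L : ℕ) * (∑ i ∈ Finset.range (k + 1), (P.L : ℝ) ^ i) * a := by
          rw [Finset.sum_range_succ]; ring

/-- The geometric sum is below `L^k` (`L ≥ 2`): `Σ_{i<k} L^i ≤ L^k − 1 < L^k`. [folklore] -/
theorem sum_range_pow_le (k : ℕ) : (∑ i ∈ Finset.range k, (P.L : ℝ) ^ i) ≤ (P.L : ℝ) ^ k := by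
  have hL : (2 : ℝ) ≤ P.L := by exact_mod_cast P.hL.2
  induction k with
  | zero => simp
  | succ k ih =>
    rw [Finset.sum_range_succ, pow_succ]
    have hk : (0 : ℝ) ≤ (P.L : ℝ) ^ k := by positivity
    nlinarith

include hΛ0 hΛs in
/-- **LOCAL SIZE OF `Λ_k`, SIMPLIFIED**: `‖Λ_k(Y)(y)‖ ≤ (d+2)L^{k+1}·a`. [cite: Balaban1985Averaging, (62) p.28] -/
theorem norm_combFamily_le {k : ℕ} (hk : k ≤ P.m + P.K) (Y : PBond P 0 → Matrix n n ℂ) (y : Site P k) {a : ℝ} (ha : 0 ≤ a)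
    (h : ∀ b : PBond P 0, iterBlockOf k b.src = y → iterBlockOf k b.tgt = y → ‖Y b‖ ≤ a) :
    ‖Λ k Y y‖ ≤ ((P.d + 2) * P.L : ℕ) * (P.L : ℝ) ^ k * a := by
  refine (norm_combFamily_le_of_local Λ hΛ0 hΛs k hk Y y ha h).trans ?_
  have hpos : (0 : ℝ) ≤ ((P.d + 2) * P.L : ℕ) := by positivity
  exact mul_le_mul_of_nonneg_right (mul_le_mul_of_nonneg_left (sum_range_pow_le k) hpos) ha

end Norms

/-! ## §2 The `j`-fold centres -/

/-- `(L^{j+1} − 1)/2 = ((L−1)/2)·L^j + (L^j − 1)/2` for odd `L`. [folklore] -/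
theorem half_pow_succ_sub_one (j : ℕ) : (P.L ^ (j + 1) - 1) / 2 = (P.L - 1) / 2 * P.L ^ j + (P.L ^ j - 1) / 2 := by
  obtain ⟨a, ha⟩ := P.hL.1
  obtain ⟨b, hb⟩ : Odd (P.L ^ j) := P.hL.1.pow
  rw [pow_succ, hb, ha]
  have h1 : (2 * a + 1 - 1) / 2 = a := by omega
  have h2 : (2 * b + 1 - 1) / 2 = b := by omega
  have h3 : ((2 * b + 1) * (2 * a + 1) - 1) / 2 = 2 * a * b + a + b := by
    have : (2 * b + 1) * (2 * a + 1) - 1 = 2 * (2 * a * b + a + b) := by ring_nf; omega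
    rw [this]; omega
  rw [h1, h2, h3]; ring

/-- **THE LABELS OF THE `j`-FOLD CENTRE**: `(embIter j y)_μ = y_μ·L^j + (L^j − 1)/2` (`j ≤ m + K`, `L` odd). [cite: Balaban1987RG1, (0.1) p.251] -/
theorem val_embIter : ∀ (j : ℕ), j ≤ P.m + P.K → ∀ (y : Site P j) (μ : Fin P.d),
    ((embIter j y) μ).val = (y μ).val * P.L ^ j + (P.L ^ j - 1) / 2
  | 0, _, y, μ => by simp [embIter]
  | j + 1, hj, y, μ => by
    show ((embIter j (emb y)) μ).val = _
    rw [val_embIter j (by omega) (emb y) μ, Site.val_emb hj, half_pow_succ_sub_one, pow_succ]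
    ring

/-- The in-block label of the `j`-fold centre is the central one: `(embIter j y)_μ mod L^j = (L^j − 1)/2`. [cite: Balaban1987RG1, (0.1) p.251] -/
theorem val_embIter_mod {j : ℕ} (hj : j ≤ P.m + P.K) (y : Site P j) (μ : Fin P.d) :
    ((embIter j y) μ).val % P.L ^ j = (P.L ^ j - 1) / 2 := by
  rw [val_embIter j hj, Nat.mul_add_mod_of_lt]
  have : 0 < P.L ^ j := pow_pos P.L_pos j
  omega


end Summit.QuantumFields.YangMills.Theorems.ChartHInv

end
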